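import Literature.MathematicalPhysics.QuantumFieldTheory.Balaban1983to89.Node00.N02Dossier
import Literature.MathematicalPhysics.QuantumFieldTheory.Balaban1983to89.B5Hk163Form166

/-!
# NODE N02 · [Balaban1984PropagatorsI] — DOSSIER SUPPLEMENT: leg 3's `⟨B, Δ_kB⟩` AT THE FORM FAMILY OF RECORD IS THE GENUINE
# (1.65) FORM `⟨∂H_kB, ∂H_kB⟩` (with `H_k` the minimiser of (1.58)∕(1.63) = `GQ*(QGQ*)⁻¹` of (1.103)), so the leaf's (1.67) is (1.67)
# for Bałaban's `Δ_k` — the located caveat «(1.65) = (1.66) uncertified» is CLOSED in the tree, by name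

TRACK A (YM-PLAN §2, node N02), seat `pub-ymgap-dag-n02-a` (prover, -a KNIT-BY-NAME), supplement to `Node00.N02Dossier` (p408822 ca0acce1d8ca) answering
the discharge referee's pre-read item (5) (ref-C, pub-ymgap INBOX l.8941: «(1.65) = (1.66) uncertified (B5Bounds167Lattice ‹What is NOT claimed› (1)) will be a
located GAP-STATED caveat if `B5.Bounds167` uses the third expression of (1.66) only»).  THEOREMS ONLY, def-free, sorry-free, standard axioms; everything
below is an existing kernel theorem of the tree used BY NAME — the junction module `B5Hk163Form166` (lit-balaban ∕ β sub-cell lineage) PROVES the printed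
sentence p. 29 «Using formulas (1.60) or (1.63) we obtain the following expression (1.66)» for the typed objects: `DelK_form_re_eq_formDk : Re⟨B, Δ_kB⟩ =
formDk B` where `Δ_k := n^{−d}·H_kᴴ(½ curlᴴcurl)H_k` is THE (1.65) OPERATOR (`Beta.BlockEffectiveAction.DelK`, `⟨B, Δ_kB⟩ = ⟨∂H_kB, ∂H_kB⟩`) built on
`H_k = GQ*(QGQ*)⁻¹` of (1.103) (`Beta.FluctuationProjection.Hk`), itself EQUAL to the (1.63)-operator ∕ the unique minimiser of p. 33 «a minimum of the form
½⟨A, Δ_aA⟩ − a⟨B, B⟩ under the conditions QA = B, R∂*A = 0» (`B5Hk163Form166.HkOp_eq_Hk`), and `formDk` is pv15's (1.66)-DEFINED form — the `formΔk`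
field of the family of record `Node00.formsOfRecord D L` (`= formOfLatticeR`, real configurations read through `ofRealCfg`).

WHAT THIS FILE RECORDS (0 sorry; axioms standard), for every member `i : TopIdx D L` of [B5]'s top-level tori (fine lattice `n = nP i.P = L^K` points per
unit interval, unit torus `M_μ = sitesPerDir i.P K = 2L^m`), every `a > 0` (a DUMMY in `Δ_k`: `Beta.BlockEffectiveAction.DelK_indep`), every REAL `B`:
* `N02_formsOfRecord_formΔk_eq_genuine165` — `(formsOfRecord D L i).formΔk B = Re⟨B̂, Δ_k B̂⟩`, `B̂ := ofRealCfg B` (the genuine (1.65) form);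
* `N02_formsOfRecord_d1Sq` — `(formsOfRecord D L i).d1Sq B = ⟨∂₁B̂, ∂₁B̂⟩` (`rfl`);
* `N02_Hk163_eq_Hk1103_at_record` — on the member's lattices the (1.63) operator IS (1.103)'s `GQ*(QGQ*)⁻¹` (`HkOp_eq_Hk` by name);
* `N02_ineq167_genuine165_at_record` — (1.67) for the GENUINE `Δ_k` at every member and every real `B`, with the lineage's constants
  `(4∕π²)^{D+2}`, `(π²∕4)^{2D+4}` (pv15 via the junction) AND the β cell's sharper `1`, `gamma1 D = (π²∕4)^{D+2}` (`Beta.Ineq167OperatorUpper.ineq167_DelK`);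
* `N02_leg_bounds167_is_genuine` — packaging: leg 3 of the dossier (`B5.Bounds167 (formsOfRecord D L)`) TOGETHER WITH the pointwise identity of its `formΔk`
  with the (1.65) form — i.e. the leaf's conjunct 3 is print's (1.67) for print's `Δ_k`, not merely for a (1.66)-defined surrogate.
* Appendix (append-only): `N02_G_symmetric_at_record` — Prop. 1.1's first clause «G is a symmetric operator» (not carried by the typed leaf) at every member,
  by `B5Prop11Lattice.DeltaA_inv_isHermitian` (+ `DeltaA_inv_posDef`); `N02_forms190_at_record` — the objects of (1.90) (`formΔa = Re⟨Â, Δ_aÂ⟩`, `formΔI =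
  Re⟨Â, (Δ+I)Â⟩`, `rfl`).  (Discharge referee READ #3, located footnote (ii).)
* Appendix 2 (append-only, g2): `N02_leg_prop12_global115_117` ∕ `N02_leg_prop12_110_to_117` — Prop. 1.2's global consequences (1.115)–(1.117) p. 36 at the
  G-family of record (`B5Prop12GHolds.global115_117_famG_printed` by name), so the locator of record «Prop. 1.2 (1.110)–(1.117)» is covered in full;
  `N02_reindexing_onto` ∕ `N02_legs_at_every_printed_instance` — the index of record `TopIdx D L` is ONTO the printed instances `(m, k ≥ 1)` (R325 D2
  «re-indexing without loss», kernel form), and the three legs hold at every one of them.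
* Appendix 3 (append-only, g2): `N02_eq164_at_record` ∕ `N02_eq164_genuine165_at_record` ∕ `N02_eq164_sandwich167_at_record` — **(1.64) p. 29 AT THE
  RECORD'S LATTICES, BY NAME**: at every member `i : TopIdx D L` the k-fold renormalisation image `(ST)^K e^{−S}` ((1.17), the lineage's
  `B5SectBStatements.iterST` down the tower `towerM L M K`, `M_μ = sitesPerDir i.P K`) of the free unit-lattice Gibbs density IS `Z·exp(−½·formΔk B)` with
  leg 3's `formΔk` = `Z·exp(−½ Re⟨B̂, Δ_kB̂⟩)` with the genuine (1.65) operator, `Z > 0`, and has the (1.67) Gaussian sandwich — p21's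
  `B5Eq166GaussDeltaK.iterST_eq_exp_formDk` ∕ `iterST_eq_exp_DelK` ∕ `iterST_sandwich` (met by p16's `B5Eq165DeltaK.eq164`, p38's `B5Eq164LandauV1.eq164`)
  at `(i.P.L, sitesPerDir i.P K, i.P.K)`; `d ≥ 2`, U = 1 torus model as in the lineage.
HONEST FRAMING: kernel bookkeeping over `B5Hk163Form166` ∕ `Beta.Ineq167Operator(Upper)` ∕ `B5Bounds167Lattice` by name; torus model of the lineage (`U = 1`,
`m² = 0`, unitary-DFT torus sum for `(2π)^{−d}∫dp′`, as recorded there); NOT claimed: the Gaussian integral (1.64) itself (that `(ST)^k e^{−S}` has covariance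
`Δ_k` — the lineage's `B5Hk103Minimizer` ∕ `Beta.BlockEffectiveAction` carry what is typed of it) — SUPERSEDED by Appendix 3: (1.64) IS recorded at
the objects of record (U = 1, `d ≥ 2`), by name over p16 ∕ p21 ∕ p38's kernel theorems —, anything continuum ∕ ℝ⁴ ∕ OS ∕ mass-gap ∕ Clay.
Count-neutral; the referee (ref-C) and the leads own the species words.
-/

noncomputable section

namespace Literature.MathematicalPhysics.QuantumFieldTheory.Balaban1983to89.Node00

open scoped Matrix
open DagBinding
open B5 (Bounds167)
open B5ResidualGpTorusHolds (TopIdx)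
open B5SiteBridgeP12 (nP one_le_nP)
open B5Bounds167Lattice (ofRealCfg formDk d1Sq)
open B5Hk163Form166 (DelK_form_re_eq_formDk HkOp_eq_Hk ineq167_DelK_via166)
open Beta.BlockEffectiveAction (DelK)
open Beta.FluctuationProjection (Hk)
open Beta.Ineq167OperatorUpper (ineq167_DelK gamma1)
open B5Hk163Torus (HkOp)

variable {D L : ℕ} (i : TopIdx D L) {a : ℝ} (ha : 0 < a)

/-- **Leg 3's `formΔk` at the family of record IS the genuine (1.65) form**: for the member `i` (fine lattice `nP i.P = L^K`, unit torus
`sitesPerDir i.P K = 2L^m` per direction) and every REAL unit-lattice vector field `B`, `(formsOfRecord D L i).formΔk B = Re⟨B̂, Δ_k B̂⟩` with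
`B̂ = ofRealCfg B` and `Δ_k = n^{−d}·H_kᴴ(½ curlᴴcurl)H_k` the (1.65) operator on `H_k = GQ*(QGQ*)⁻¹` ((1.103); `a > 0` a dummy) — the junction
`B5Hk163Form166.DelK_form_re_eq_formDk` BY NAME. [cite: Balaban1984PropagatorsI, (1.65)–(1.66) p.29 («The action Δ_k is thus defined by ⟨B, Δ_kB⟩ = ⟨∂H_kB, ∂H_kB⟩. (1.65) Using formulas (1.60) or (1.63) we obtain the following expression … (1.66)»), (1.103) p.34] -/
theorem N02_formsOfRecord_formΔk_eq_genuine165 (B : (formsOfRecord D L i).Cfg) :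
    (formsOfRecord D L i).formΔk B =
      (star (ofRealCfg (fun _ : Fin D => i.P.sitesPerDir i.P.K) B) ⬝ᵥ
        (DelK (nP i.P) (one_le_nP i.P) (fun _ : Fin D => i.P.sitesPerDir i.P.K) a ha *ᵥ
          ofRealCfg (fun _ : Fin D => i.P.sitesPerDir i.P.K) B)).re :=
  (DelK_form_re_eq_formDk (nP i.P) (one_le_nP i.P) (fun _ : Fin D => i.P.sitesPerDir i.P.K) a ha
    (ofRealCfg (fun _ : Fin D => i.P.sitesPerDir i.P.K) B)).symm

/-- Leg 3's `d1Sq` at the family of record is `⟨∂₁B̂, ∂₁B̂⟩` (`½ Σ_{μ,ν} Σ_x |(∂₁B)_{μν}(x)|²`, pv15's `d1Sq`) at `B̂ = ofRealCfg B` (`rfl`).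
[cite: Balaban1984PropagatorsI, (1.66)–(1.67) p.29 (⟨∂₁B, ∂₁B⟩; dictionary)] -/
theorem N02_formsOfRecord_d1Sq (B : (formsOfRecord D L i).Cfg) :
    (formsOfRecord D L i).d1Sq B = d1Sq (fun _ : Fin D => i.P.sitesPerDir i.P.K) (ofRealCfg (fun _ : Fin D => i.P.sitesPerDir i.P.K) B) :=
  rfl

/-- **On the member's lattices the (1.63) operator `H_k` IS (1.103)'s `GQ*(QGQ*)⁻¹`** (every `a > 0`): `B5Hk163Form166.HkOp_eq_Hk` BY NAME — the typed
minimiser of p. 33 («It is defined as a minimum of the form ½⟨A, Δ_aA⟩ − a⟨B, B⟩ under the conditions QA = B, R∂*A = 0») and the representation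
(1.103) coincide, so the `Δ_k` of `N02_formsOfRecord_formΔk_eq_genuine165` is built on Bałaban's `H_k`. [cite: Balaban1984PropagatorsI, (1.58) p.27, (1.63) p.28, (1.103) p.34] -/
theorem N02_Hk163_eq_Hk1103_at_record :
    HkOp (nP i.P) (fun _ : Fin D => i.P.sitesPerDir i.P.K) =
      Hk (nP i.P) (one_le_nP i.P) (fun _ : Fin D => i.P.sitesPerDir i.P.K) a ha :=
  HkOp_eq_Hk (nP i.P) (one_le_nP i.P) (fun _ : Fin D => i.P.sitesPerDir i.P.K) a ha

/-- **(1.67) for the GENUINE `Δ_k` at every member of the family of record and every real `B`**, with BOTH certified pairs of constants: the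
lineage's `(4∕π²)^{D+2} ⟨∂₁B̂,∂₁B̂⟩ ≤ Re⟨B̂, Δ_kB̂⟩ ≤ (π²∕4)^{2D+4} ⟨∂₁B̂,∂₁B̂⟩` (pv15's `ineq167` through the junction, `ineq167_DelK_via166`) and the β
cell's sharper `⟨∂₁B̂,∂₁B̂⟩ ≤ Re⟨B̂, Δ_kB̂⟩ ≤ (π²∕4)^{D+2} ⟨∂₁B̂,∂₁B̂⟩` (`Beta.Ineq167OperatorUpper.ineq167_DelK`); print asserts `γ₀, γ₁ > 0` «depending on
d only» without values. [cite: Balaban1984PropagatorsI, (1.67) p.29] -/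
theorem N02_ineq167_genuine165_at_record (B : (formsOfRecord D L i).Cfg) :
    ((4 / Real.pi ^ 2) ^ (D + 2) * (formsOfRecord D L i).d1Sq B ≤
        (star (ofRealCfg (fun _ : Fin D => i.P.sitesPerDir i.P.K) B) ⬝ᵥ
          (DelK (nP i.P) (one_le_nP i.P) (fun _ : Fin D => i.P.sitesPerDir i.P.K) a ha *ᵥ
            ofRealCfg (fun _ : Fin D => i.P.sitesPerDir i.P.K) B)).re ∧
      (star (ofRealCfg (fun _ : Fin D => i.P.sitesPerDir i.P.K) B) ⬝ᵥ
          (DelK (nP i.P) (one_le_nP i.P) (fun _ : Fin D => i.P.sitesPerDir i.P.K) a ha *ᵥ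
            ofRealCfg (fun _ : Fin D => i.P.sitesPerDir i.P.K) B)).re ≤
        (Real.pi ^ 2 / 4) ^ (2 * D + 4) * (formsOfRecord D L i).d1Sq B) ∧
    ((formsOfRecord D L i).d1Sq B ≤
        (star (ofRealCfg (fun _ : Fin D => i.P.sitesPerDir i.P.K) B) ⬝ᵥ
          (DelK (nP i.P) (one_le_nP i.P) (fun _ : Fin D => i.P.sitesPerDir i.P.K) a ha *ᵥ
            ofRealCfg (fun _ : Fin D => i.P.sitesPerDir i.P.K) B)).re ∧
      (star (ofRealCfg (fun _ : Fin D => i.P.sitesPerDir i.P.K) B) ⬝ᵥ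
          (DelK (nP i.P) (one_le_nP i.P) (fun _ : Fin D => i.P.sitesPerDir i.P.K) a ha *ᵥ
            ofRealCfg (fun _ : Fin D => i.P.sitesPerDir i.P.K) B)).re ≤
        gamma1 D * (formsOfRecord D L i).d1Sq B) :=
  ⟨ineq167_DelK_via166 (nP i.P) (one_le_nP i.P) (fun _ : Fin D => i.P.sitesPerDir i.P.K) a ha _,
    ineq167_DelK (nP i.P) (one_le_nP i.P) (fun _ : Fin D => i.P.sitesPerDir i.P.K) a ha _⟩

/-- **LEG 3 IS PRINT'S (1.67) FOR PRINT'S `Δ_k`** (packaging for the referee): `B5.Bounds167 (formsOfRecord D L)` (the leaf's conjunct 3, dossier leg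
`N02_leg_bounds167`) TOGETHER WITH the pointwise identity of every member's `formΔk` with the genuine (1.65) form `Re⟨B̂, Δ_kB̂⟩` and of `d1Sq` with
`⟨∂₁B̂, ∂₁B̂⟩`.  So the located caveat «(1.65) = (1.66) uncertified» of `B5Bounds167Lattice`'s header is CLOSED at the objects of record by
`B5Hk163Form166` (its «pv15's NOT-claimed (1) is thereby kernel-closed»). [cite: Balaban1984PropagatorsI, (1.65)–(1.67) p.29] -/
theorem N02_leg_bounds167_is_genuine (D L : ℕ) {a : ℝ} (ha : 0 < a) :
    Bounds167 (formsOfRecord D L) ∧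
      ∀ (i : TopIdx D L) (B : (formsOfRecord D L i).Cfg),
        (formsOfRecord D L i).formΔk B =
            (star (ofRealCfg (fun _ : Fin D => i.P.sitesPerDir i.P.K) B) ⬝ᵥ
              (DelK (nP i.P) (one_le_nP i.P) (fun _ : Fin D => i.P.sitesPerDir i.P.K) a ha *ᵥ
                ofRealCfg (fun _ : Fin D => i.P.sitesPerDir i.P.K) B)).re ∧
          (formsOfRecord D L i).d1Sq B =
            d1Sq (fun _ : Fin D => i.P.sitesPerDir i.P.K) (ofRealCfg (fun _ : Fin D => i.P.sitesPerDir i.P.K) B) :=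
  ⟨bounds167_formsOfRecord D L, fun i B => ⟨N02_formsOfRecord_formΔk_eq_genuine165 i ha B, N02_formsOfRecord_d1Sq i B⟩⟩

/-! ## Appendix (append-only, same seat): Prop. 1.1's clause «The operator G is a symmetric operator on L²(T_η)» and the objects of (1.90)
## AT THE G-FAMILY OF RECORD, by name (the discharge referee's located footnote (ii), READ #3) -/

section Symmetric

open scoped ComplexOrder
open B5Prop12GLattice (famG)
open B5SiteBridgeP12 (MP)
open B5DeltaA169 (DeltaA)
open B5Prop11Lower (Lap)
open B5SettingP12Real (embV)
open B5Prop11Lattice (DeltaA_inv_isHermitian DeltaA_inv_posDef)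

include ha in
/-- **«The operator G is a symmetric operator on L²(T_η)» (Prop. 1.1 p. 33, first clause) AT EVERY MEMBER OF THE G-FAMILY OF RECORD** — a clause the typed
leaf `B5.Prop11Printed` does not carry (it records (1.89)–(1.90) only), in the tree BY NAME: the member's propagator `G = Δ_a⁻¹ = (DeltaA (nP i.P) (MP i.P) a)⁻¹`
is Hermitian (`B5Prop11Lattice.DeltaA_inv_isHermitian`) — and positive definite (`DeltaA_inv_posDef`; p. 30 «At first let us prove that Δ_a is a positive
operator … It is an invertible operator»). [cite: Balaban1984PropagatorsI, Prop. 1.1 p.33 (first clause), (1.71)–(1.73) p.30] -/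
theorem N02_G_symmetric_at_record :
    ((DeltaA (nP i.P) (MP i.P) a)⁻¹).IsHermitian ∧ ((DeltaA (nP i.P) (MP i.P) a)⁻¹).PosDef :=
  ⟨DeltaA_inv_isHermitian (nP i.P) (one_le_nP i.P) (MP i.P) a ha, DeltaA_inv_posDef (nP i.P) (one_le_nP i.P) (MP i.P) a ha⟩

/-- **The objects of (1.90) «Δ_a = G⁻¹ ≥ γ₀(Δ + I)» at the member** (`rfl`): the leaf's `formΔa A = Re⟨Â, Δ_a Â⟩` with `Δ_a = DeltaA = Lap − ∂P∂ᴴ + aQ*Q`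
((1.69)∕(1.73), `B5DeltaA169`) and `formΔI A = Re⟨Â, (Δ + I) Â⟩` with `Δ = Lap` the η-lattice Laplacian (1.21), `Â = embV A` the real vector field read in `ℂ` —
so `Prop11Printed`'s second clause `γ₀ · formΔI A ≤ formΔa A` IS (1.90) for `G⁻¹ = Δ_a` on real fields. [cite: Balaban1984PropagatorsI, Prop. 1.1 (1.90) p.33, (1.69) p.29, (1.73) p.30 (dictionary)] -/
theorem N02_forms190_at_record (A : (famG D L a i).Vec) :
    (famG D L a i).formΔa A = (star (embV A) ⬝ᵥ (DeltaA (nP i.P) (MP i.P) a *ᵥ embV A)).re ∧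
      (famG D L a i).formΔI A = (star (embV A) ⬝ᵥ ((Lap (nP i.P) (MP i.P) + 1) *ᵥ embV A)).re :=
  ⟨rfl, rfl⟩

end Symmetric

/-! ## Appendix 2 (append-only, same seat, g2): Prop. 1.2's GLOBAL consequences (1.115)–(1.117) p. 36 AT THE G-FAMILY OF RECORD — so the locator of
## record «Prop. 1.2 (1.110)–(1.117) pp. 35–36» (ROSTER-D0062 row n02) is covered by name IN FULL (the dossier's leg 2 is the typed leaf's (1.110)–(1.114)) —,
## and the re-indexing of record R325 D2 («[B5]'s scale-k instance of the run (m′, K′) is the top-level member (m′ + K′ − k, k) — WITHOUT LOSS») as a kernel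
## fact: the index of record `TopIdx D L` is ONTO the printed instances (every torus exponent `m`, every scale `k ≥ 1`) -/

section Global

open B5 (Prop12Printed Global115_117Fam)
open B5Prop12GLattice (famG)
open B5SiteBridgeP12 (MP sitesPerDir_K_eq)
open B5SettingP12Real (gP12R)
open B5Prop12GHolds (global115_117_famG_printed)

/-- **(1.115)–(1.117) p. 36 AT THE G-FAMILY OF RECORD** (admissible Stage-1 parameters `θ`): «The localized inequalities (1.110)–(1.114) imply immediately the
following global inequalities |GJ|, |∇GJ|, |G∇*J|, |ΔGJ|, ‖∇GJ‖_α, ‖G∇*J‖_α ≤ O(1)|J|, (1.115) |∇G∇*J| ≤ O(1)(‖J‖_ε + |J|), (1.116) ‖∇G∇*J‖_α ≤ O(1)(‖J‖_{α+ε} +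
|J|), (1.117) and (1.89), with the same dependence of the constants O(1).» — the typed family statement `B5.Global115_117Fam` at `famG D L a` with the GLOBAL
Hölder functionals of record `gP12R` (r02's cover of record), constants chosen before the member; the lineage's `B5Prop12GHolds.global115_117_famG_printed` BY
NAME (⇐ `B5Prop12GLattice.global115_117_famG` ⇐ `B5Global115.global_of_prop12`: the word «immediately» = summation over the unit cubes against the row sums
`Σ_{y′} e^{−δ₀|y−y′|}`).  The clause «and (1.89)» is leg 1 (`N02_leg_prop11`).  Not carried by the typed leaf `B5.MainBlock`; recorded here so that the node's
locator of record (1.110)–(1.117) is a tree theorem at the objects of record end to end. [cite: Balaban1984PropagatorsI, (1.115)–(1.117) p.36] -/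
theorem N02_leg_prop12_global115_117 (θ : Stage1Params) (hθ : θ.Admissible) :
    Global115_117Fam (famG θ.D θ.L θ.a) (fun i => gP12R (MP i.P) (nP i.P) θ.a i.P.K) := by
  obtain ⟨hD, _, _, _, _, ha0, _⟩ := hθ
  exact global115_117_famG_printed (le_trans one_le_two hD) θ.hL ha0

/-- **PROPOSITION 1.2 AS THE LOCATOR OF RECORD READS IT — (1.110)–(1.117) pp. 35–36 — AT THE G-FAMILY OF RECORD**: the typed Proposition 1.2 (`B5.Prop12Printed` =
(1.110)–(1.114), dossier leg 2 `N02_leg_prop12`) AND its printed global consequences (1.115)–(1.117) (`N02_leg_prop12_global115_117`), one conjunction, admissible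
`θ`. [cite: Balaban1984PropagatorsI, Prop. 1.2 (1.110)–(1.114) pp.35–36 and (1.115)–(1.117) p.36 (packaging, bookkeeping)] -/
theorem N02_leg_prop12_110_to_117 (θ : Stage1Params) (hθ : θ.Admissible) :
    Prop12Printed (famG θ.D θ.L θ.a) ∧ Global115_117Fam (famG θ.D θ.L θ.a) (fun i => gP12R (MP i.P) (nP i.P) θ.a i.P.K) :=
  ⟨N02_leg_prop12 θ hθ, N02_leg_prop12_global115_117 θ hθ⟩

/-- **THE INDEX OF RECORD IS ONTO THE PRINTED INSTANCES (R325 D2 «re-indexing WITHOUT LOSS», kernel form).**  Props. 1.1–1.2 are printed for the operator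
`G = G_k` on the lattice `T_η`, `η = L^{−k}`, of a torus with `L_μ = L^m`-type periods — one instance per (torus, scale `k ≥ 1`).  For `D ≥ 1` and odd `L > 1`,
EVERY such pair `(m, k)`, `k ≥ 1`, IS a member `i` of [B5]'s top-level index of record `TopIdx D L` (the B5 index of `Node00.carriers₁`, `N02_families_of_record`):
`i.P = ⟨D, L, m, k⟩`, fine lattice `nP i.P = L^k` points per unit interval, unit lattice `MP i.P μ = 2·L^m = sitesPerDir i.P k` sites per direction — the converse
of the member dictionary `N02_index_dictionary`.  So «top-level tori only» loses no printed instance: the scale-`k` statement of a run `(m′, K′)`, `k ≤ K′`, is the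
member `(m′ + K′ − k, k)`. [cite: Balaban1984PropagatorsI, (1.1)–(1.6) pp.18–19 (the lattices T_η^{(k)}, T₁^{(k)}); Balaban1987RG1, (0.1) p.251 (L, m, K) — dictionary, bookkeeping] -/
theorem N02_reindexing_onto (hD : 1 ≤ D) (hL : Odd L ∧ 1 < L) (m k : ℕ) (hk : 1 ≤ k) :
    ∃ i : TopIdx D L, i.P.m = m ∧ i.P.K = k ∧ nP i.P = L ^ k ∧ (∀ μ, MP i.P μ = 2 * L ^ m) ∧
      i.P.sitesPerDir i.P.K = 2 * L ^ m := by
  let P : Params := ⟨D, L, m, k, hD, hL⟩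
  have hμ : 0 < P.d := hD
  refine ⟨⟨P, rfl, rfl, hk⟩, rfl, rfl, rfl, fun _ => rfl, ?_⟩
  exact (sitesPerDir_K_eq P ⟨0, hμ⟩).trans rfl

/-- **… hence the node's three legs are available AT EVERY PRINTED INSTANCE**: for admissible `θ` and every `(m, k ≥ 1)` there is a member `i : TopIdx θ.D θ.L`
with `(i.P.m, i.P.K) = (m, k)`, and Prop. 1.1 ∧ Prop. 1.2 (with (1.115)–(1.117)) ∧ (1.67) hold for the families of record it belongs to (family statements,
constants before the member). [cite: Balaban1984PropagatorsI, Prop. 1.1 p.33, Prop. 1.2 pp.35–36, (1.67) p.29 (bookkeeping: legs × onto)] -/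
theorem N02_legs_at_every_printed_instance (θ : Stage1Params) (hθ : θ.Admissible) (m k : ℕ) (hk : 1 ≤ k) :
    (∃ i : TopIdx θ.D θ.L, i.P.m = m ∧ i.P.K = k) ∧
      B5.Prop11Printed (famG θ.D θ.L θ.a) ∧
        (Prop12Printed (famG θ.D θ.L θ.a) ∧ Global115_117Fam (famG θ.D θ.L θ.a) (fun i => gP12R (MP i.P) (nP i.P) θ.a i.P.K)) ∧
          Bounds167 (formsOfRecord θ.D θ.L) := by
  obtain ⟨i, hm, hK, -⟩ := N02_reindexing_onto (le_trans one_le_two hθ.1) θ.hL m k hk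
  exact ⟨⟨i, hm, hK⟩, N02_leg_prop11 θ hθ, N02_leg_prop12_110_to_117 θ hθ, N02_leg_bounds167 θ⟩

end Global

/-! ## Appendix 3 (append-only, same seat, g2): **(1.64) p. 29 AT THE RECORD'S LATTICES, BY NAME** — «Let us now come back to the integral (1.47).
## We make the translation A = A′ + H_kB and using the above properties of H_kB, we get ((ST)^k e^{−S})(B) = Z_k exp(−½⟨∂H_kB, ∂H_kB⟩). (1.64) The
## action Δ_k is thus defined by ⟨B, Δ_kB⟩ = ⟨∂H_kB, ∂H_kB⟩. (1.65)».  The k-fold renormalisation image `(ST)^k e^{−S}` ((1.16)–(1.17) p. 20, the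
## lineage's `B5SectBStatements.iterST` over the tower of tori `towerM L M k`) of the free unit-lattice Gibbs density IS the centred Gaussian whose
## covariance form is leg 3's `formΔk` = the GENUINE (1.65) form of Appendix 1 — at every member `i : TopIdx D L` of [B5]'s index of record (unit torus
## `M_μ = sitesPerDir i.P K = 2L^m`, tower base `L`, top scale `k = K`, fine lattice `nP i.P = L^K` points per unit interval).  CENSUS (dag-lead word
## [DAGLEAD-G0-FREE-HANDS-1]): (1.64) is a tree theorem three times — tower∕Landau `B5Eq165DeltaK.eq164` (p16), tower∕(1.65)-operator
## `B5Eq166GaussDeltaK.iterST_eq_exp_DelK` ∕ `iterST_eq_exp_formDk` ∕ `iterST_sandwich` (p21), V1 calculus `B5Eq164LandauV1.eq164` (p38); what was missing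
## is only the junction below.  This REMOVES «the Gaussian integral (1.64) itself» from the NOT-claimed list of this file's honest framing, at the objects
## of record and in the lineage's scope (U = 1 torus model, `d ≥ 2`; `[NeZero L]` — at the record `L` is odd `> 1`). -/

section Eq164

open B5SectBStatements (iterST action1)
open B5Eq166GaussDeltaK (iterST_eq_exp_DelK iterST_eq_exp_formDk iterST_sandwich)

variable [NeZero L]

/-- **(1.64) AT THE MEMBER `i` OF THE INDEX OF RECORD, WITH LEG 3's FORM**: for `D ≥ 2` there is `Z > 0` («Z_k», here `Z_{k,Ax}·z^{(k)}` of (1.17)∕(1.19))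
such that for every REAL unit-lattice field `B` on the member's unit torus (`(formsOfRecord D L i).Cfg = (Tor M × Fin D → ℝ)`, `M_μ = sitesPerDir i.P K`)
`((ST)^K e^{−S})(B) = Z · exp(−½ · (formsOfRecord D L i).formΔk B)` — the k-fold iterate (1.17) of «renormalisation transformation (1.12), then
rescaling» down the tower `towerM L M K` (finest level `L^K·M_μ = 2L^{m+K}` sites per direction = the member's `T_η`), applied to `e^{−S}` with `S` the
unit-lattice action (1.5), evaluated at `B`; the exponent is EXACTLY the `formΔk` of the node's leg 3 (`Bounds167 (formsOfRecord D L)`), i.e. (1.64) with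
(1.66).  The lineage's `B5Eq166GaussDeltaK.iterST_eq_exp_formDk` BY NAME at `(L, M, k) := (i.P.L, sitesPerDir i.P K, i.P.K)` (`nP i.P = L^K` and
`cplx (toLp B) = ofRealCfg M B` are `rfl`). [cite: Balaban1984PropagatorsI, (1.64) p.29, (1.17)–(1.19) p.20, (1.66) p.29] -/
theorem N02_eq164_at_record (hD : 2 ≤ D) :
    ∃ Z : ℝ, 0 < Z ∧ ∀ B : (formsOfRecord D L i).Cfg,
      iterST L (fun _ : Fin D => i.P.sitesPerDir i.P.K) i.P.K (fun A => Real.exp (-action1 A)) (WithLp.toLp 2 B)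
        = Z * Real.exp (-(1 / 2 * (formsOfRecord D L i).formΔk B)) := by
  obtain ⟨P, hPd, hPL, -⟩ := i
  subst hPd; subst hPL
  obtain ⟨Z, hZ, h⟩ := iterST_eq_exp_formDk P.L (fun _ : Fin P.d => P.sitesPerDir P.K) hD P.K
  exact ⟨Z, hZ, fun B => h (WithLp.toLp 2 B)⟩

/-- **(1.64)–(1.65) AT THE MEMBER WITH THE GENUINE OPERATOR `Δ_k`**: same `(ST)^K e^{−S}`, exponent `−½ Re⟨B̂, Δ_k B̂⟩` with `Δ_k = n^{−d}·H_kᴴ(½ curlᴴcurl)H_k`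
THE (1.65) operator on `H_k = GQ*(QGQ*)⁻¹` ((1.103); Appendix 1's `DelK (nP i.P) …`, `a > 0` a dummy) and `B̂ = ofRealCfg B` — so the three typed presentations
of Bałaban's `Δ_k` at the record (Gaussian DEFINITION (1.19)∕(1.64), variational∕closed form (1.65)∕(1.103), momentum form (1.66) = leg 3) are ONE.  The
lineage's `B5Eq166GaussDeltaK.iterST_eq_exp_DelK` BY NAME. [cite: Balaban1984PropagatorsI, (1.64)–(1.65) p.29, (1.103) p.34, (1.19) p.20] -/
theorem N02_eq164_genuine165_at_record (hD : 2 ≤ D) :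
    ∃ Z : ℝ, 0 < Z ∧ ∀ B : (formsOfRecord D L i).Cfg,
      iterST L (fun _ : Fin D => i.P.sitesPerDir i.P.K) i.P.K (fun A => Real.exp (-action1 A)) (WithLp.toLp 2 B)
        = Z * Real.exp (-(1 / 2 *
            (star (ofRealCfg (fun _ : Fin D => i.P.sitesPerDir i.P.K) B) ⬝ᵥ
              (DelK (nP i.P) (one_le_nP i.P) (fun _ : Fin D => i.P.sitesPerDir i.P.K) a ha *ᵥ
                ofRealCfg (fun _ : Fin D => i.P.sitesPerDir i.P.K) B)).re)) := by
  obtain ⟨P, hPd, hPL, -⟩ := i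
  subst hPd; subst hPL
  obtain ⟨Z, hZ, h⟩ := iterST_eq_exp_DelK P.L (fun _ : Fin P.d => P.sitesPerDir P.K) hD P.K (one_le_nP P) a ha
  exact ⟨Z, hZ, fun B => h (WithLp.toLp 2 B)⟩

/-- **… AND ITS (1.67) GAUSSIAN SANDWICH with leg 3's `⟨∂₁B, ∂₁B⟩`**: `Z·e^{−½γ₁⟨∂₁B̂,∂₁B̂⟩} ≤ ((ST)^K e^{−S})(B) ≤ Z·e^{−½⟨∂₁B̂,∂₁B̂⟩}`, `γ₁ = gamma1 D = (π²∕4)^{D+2}`,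
`⟨∂₁B̂,∂₁B̂⟩ = (formsOfRecord D L i).d1Sq B` (the β cell's sharp (1.67) pair `1, gamma1 D` of Appendix 1, through the Gaussian) — the lineage's
`B5Eq166GaussDeltaK.iterST_sandwich` BY NAME. [cite: Balaban1984PropagatorsI, (1.67) p.29, (1.19) p.20] -/
theorem N02_eq164_sandwich167_at_record (hD : 2 ≤ D) :
    ∃ Z : ℝ, 0 < Z ∧ ∀ B : (formsOfRecord D L i).Cfg,
      Z * Real.exp (-(1 / 2 * (gamma1 D * (formsOfRecord D L i).d1Sq B)))
          ≤ iterST L (fun _ : Fin D => i.P.sitesPerDir i.P.K) i.P.K (fun A => Real.exp (-action1 A)) (WithLp.toLp 2 B) ∧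
        iterST L (fun _ : Fin D => i.P.sitesPerDir i.P.K) i.P.K (fun A => Real.exp (-action1 A)) (WithLp.toLp 2 B)
          ≤ Z * Real.exp (-(1 / 2 * (formsOfRecord D L i).d1Sq B)) := by
  obtain ⟨P, hPd, hPL, -⟩ := i
  subst hPd; subst hPL
  obtain ⟨Z, hZ, h⟩ := iterST_sandwich P.L (fun _ : Fin P.d => P.sitesPerDir P.K) hD P.K
  exact ⟨Z, hZ, fun B => h (WithLp.toLp 2 B)⟩

end Eq164

end Literature.MathematicalPhysics.QuantumFieldTheory.Balaban1983to89.Node00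

end
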